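import Literature.MathematicalPhysics.QuantumFieldTheory.Balaban1983to89.B9Ineq377POne

/-!
# `Balaban1983to89.B9Ineq385VG` — B9 p. 407 (3.83), (3.85), (3.86): the kernel bound for `P₂(A)`, the bound
# `|(V(A)G(U)J)(b)| ≦ O(1)α₁e^{−(1/2)δ₀d(y,y′)}|J|` and the first Theorem-3.3 inequality for `G(U′U) = G(U)(I − V(A)G(U))⁻¹`,
# in the block-majorant (operator) form of [4] (2.51), DERIVED from (3.73)/(3.77)/(3.81)/(3.83)-shaped inputs and the
# Theorem-3.3 entries of `G(U)`

HONEST FRAMING (cell `lit-balaban`, verbatim): statement-level skeleton of published theorems with citation tags; proofs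
where landed; nothing here is a claim about the Yang–Mills mass gap.

CITATION HEADER (lean-in-tree rule).  T. Bałaban, *Propagators for lattice gauge theories in a background field*, Commun.
Math. Phys. **99** (1985) 389–434 [`Balaban1985BackgroundPropagators`] (cell paper B9; journal page = PDF page + 388):
p. 407 [PDF 19] (3.82)–(3.86) with the sentences between them; p. 405 [PDF 17] (3.73); p. 406 [PDF 18] (3.77), (3.80)–(3.81);
p. 399 [PDF 11] Theorem 3.3; p. 397 [PDF 9] (3.42); p. 394–395 [PDF 6–7] (3.24), (3.26); [4] = T. Bałaban, *Propagators and
renormalization transformations for lattice gauge theories. II*, Commun. Math. Phys. **96** (1984) 223–250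
[`Balaban1984PropagatorsII`], (2.51)–(2.55) p. 232, Lemma 2.1 p. 234, (2.64)–(2.66) p. 234.  Text read from the held text
layer (`lit read paper:balaban1985-cmp99-background-propagators --pages 14-20`) and the renders
`b2b-balaban-ref1/pages/1985-cmp99-background-propagators/…-p017/p018/p019-x2.png` READ AS IMAGES by this seat (2026-08-21).
Cell `lit-balaban` seat r06 gen 7 (B9 fold owner), SKELETON rows `B9.Eq3.82` («(3.83) and P₁, P₂ analyticity typed as
hypotheses») and `B9.Eq3.85` («(3.85) from a pointwise-decay hypothesis»).  Continuation of `B9Ineq377POne` (same seat,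
same session; (3.77) in operator form), of gen 6's `B9Ineq366CPrime`/`B9Ineq368PPrime` (composition lemmas, USED BY NAME),
of pv27's `B9Eq386Neumann` (`pTwo`, `vTotal` = the printed `P₂(A)`, `V(A)`; the Neumann series (3.86) in normed rings) and of
b09/pv08's `B9Thm34Ext.gpExt_entry1_of_365` ([4] (2.66) read through `toB6`; USED BY NAME for (3.86)).

WHAT IS PRINTED («…» verbatim, p. 407).  «= Δ_a(U) − V₃(A) − P₁(A) − P₂(A). (3.82)  The operator V₃(A) is a local
differential operator of the first order satisfying the bound (3.73). The operator P₁(A) was defined in (3.76). It is a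
non-local bounded operator and satisfies the bound (3.77). The operator P₂(A) is a sum of three terms obtained by the
expansion of averaging operators. It is a semi-local operator in the sense that the value (P₂(A)A′)(b) at a bond b ∈
B_j(Λ_j) depends on A, A′ restricted to j-blocks neighbouring the block containing the bond b. It satisfies the bound
|(P₂(A)A′)(b)| ≦ O(1)α₁(Lʲη)⁻²|A′|, b ∈ B_j(Λ_j), (3.83) with the norm |A′| restricted to the blocks defined above. The
operators V₃(A), P₁(A), P₂(A) depend analytically on A in the domain (3.37). Let us denote the sum of these three operators by V(A).
We can write (3.82) as Δ_a(U′U) = Δ_a(U) − V(A) = (I − V(A)G(U))Δ_a(U). (3.84)  Using the bounds (3.73), (3.77), (3.83) and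
assuming that Theorem 3.3 holds for G(U), we get |(V(A)G(U)J)(b)| ≦ O(1)α₁e^{−(1/2)δ₀d(y,y′)}|J| for b ∈ Δ(y), supp J ⊂ Δ(y′).
(3.85)  (Here J is an arbitrary gauge field configuration with values in 𝔤ᶜ.) This bound implies in particular the bound
|V(A)G(U)J| ≦ O(1)α₁|J|, hence V(A)G(U) is a small operator in supremum norm, and we have G(U′U) = G(U)(I − V(A)G(U))⁻¹ =
Σ_{n=0}^∞ G(U)(V(A)G(U))ⁿ, (3.86) and convergence is in the operator norm for α₁ sufficiently mall. […] Theorem (3.3) implies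
also convergence in all norms appearing in its formulation, thus in all norms on the left-hand sides of the inequalities
(3.42)–(3.47). This way we get all these inequalities for the operator G(U′U), the local ones follow from the bound (3.85) and
Lemma 2.1 [4].» [sic: «mall»].  p. 405 (3.73): «|(V₁(A)A′)(b)| ≦ O(1)(|A||∇A′| + |∇A||A′| + |A|²|A′|) ≦ O(1)α₁((Lʲη)⁻¹|∇A′| +
(Lʲη)⁻²|A′|), b ∈ Ω_j».  p. 406 (3.81): «|F_{2,j}(A)A′| ≦ … ≦ O(1)α₁Q″_j|A′| on Λ_j» and «Q*_j(U′U) = Q*_j(U) + F*_{2,j}(A),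
and F*_{2,j}(A) satisfies (3.81)».  p. 394 (3.24) «⟨λ, Q′*aQ′λ⟩ = Σ_j a_j Σ_{y∈Λ_j} (Lʲη)^{d−2}|(Q′_j(U)λ)(y)|²», p. 395 (3.26)
«Δ_a = Δ + DRD* + Q*aQ».

WHAT THIS FILE PROVES (theorems; two real-constant definitions with bodies `kappa383`, `kappa385`; no `Prop` placeholders,
0 new facts; standard axioms; v1.1 = §5 appended, §1–§4 byte-identical to v1 p254201; v1.2 = §6 appended, §1–§5 byte-identical
to v1.1 p254354; v1.3 (r06 gen 15) = DOCFIX ONLY — Q-FID row QF57-002 (summit-lit1 g57, class LB-DROP): «P₁(A),» restored in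
the p. 407 quotation above (the text layer p0019 L14/L15 drops the last token of the printed line; render p019-x2.png read) and
«𝔤ᶜ» for the printed gᶜ in the sentence after (3.85); declarations byte-identical to v1.2 p254896).  SETTING as in `B9Ineq377POne`/`B9Ineq368PPrime`: pv08's `B6RandomWalk.HasMajorant` over
`B9Thm34Ext.toB6`, all letters in ONE `Module.End ℝ (W → ℝ)` with block map `blk : W → 𝔅`.
* §1 **`ineq383_op`** — (3.83) in block-majorant (operator) form for the printed `P₂(A) = B9Eq386Neumann.pTwo Qs Q F₂ F₂s a =
  −(F₂*aQ + Q*aF₂ + F₂*aF₂)`: from `Q`, `Q* ≺ κ_Q e^{−δd}`, `F₂`, `F₂* ≺ c_Fα₁e^{−δd}` ((3.81), semi-local letters in the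
  dressed form) and the diagonal weight letter `a ≺ ā(Lʲη)⁻²·𝟙[y = y′]` ((3.24): `a_j(Lʲη)^{d−2}` against the `(Lʲη)^{−d}`
  of `Q*`): **`P₂(A) ≺ κ₃₈₃·α₁·(Lʲη)⁻²·e^{−ρd}`**, `ρ + (α+β)δ₀ ≦ δ`, **`κ₃₈₃ = āΛc·c_F(2κ_Q + c_Fα₁)`**.
* §2 **`ineq385_op`** — (3.85): with `V(A) = B9Eq386Neumann.vTotal V₃ P₁ P₂`, `V₃ = V⁰ + V¹·∇` (the first-order local
  differential structure of (3.71)/(3.75)/(3.82), (3.73): `V⁰ ≺ c_Vα₁(Lʲη)⁻²e^{−δd}`, `V¹ ≺ c_Vα₁(Lʲη)⁻¹e^{−δd}`), `P₁ ≺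
  κ₁α₁(Lʲη)⁻²e^{−δd}` ((3.77), `B9Ineq377POne`), `P₂ ≺ κ₂α₁(Lʲη)⁻²e^{−δd}` ((3.83), §1) and Theorem 3.3's entries (3.42)₁,₂
  `G ≺ B₀(Lʲη)²e^{−δd}`, `∇G ≺ B₀Lʲη e^{−δd}`, the scale transfers of `Lʲη`, `(Lʲη)²` and (2.61), (2.54):
  **`V(A)G(U) ≺ κ₃₈₅·α₁·e^{−ρ d(y,y′)}`**, `ρ + (α+β)δ₀ ≦ δ`, **`κ₃₈₅ = B₀Λc(2c_V + κ₁ + κ₂)`**.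
* §3 `supBound_of_hasMajorant`, **`supNorm_VG_le`** — «This bound implies in particular the bound |V(A)G(U)J| ≦ O(1)α₁|J|»:
  a (2.51)-majorant `K ≧ 0` bounds `|(Tμ)(x)| ≦ (Σ_{y′}K(y,y′))·sup|μ|` for EVERY bounded `μ` (decompose `μ = Σ_{y′}Δ(y′)μ`),
  hence `|(V(A)G(U)J)(b)| ≦ κ₃₈₅α₁C_ρ·sup|J|` with `C_ρ` the row sum of `e^{−ρd}` ((2.61)).
* §4 **`gExt_entry1_of_386`**, **`gExt_entry1_explicit`** — (3.86) ⇒ the first inequality (3.42)₁ of Theorem 3.3 for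
  `G(U′U)`: from the resolvent form `G(U′U) = G(U) + G(U′U)·V(A)G(U)` of (3.86), `G(U) ≺ B₀(Lʲη)²e^{−ρd}` and §2's
  `V(A)G(U) ≺ θe^{−ρd}`, by `B9Thm34Ext.gpExt_entry1_of_365` ([4] (2.66)): `G(U′U) ≺ B₀c₁(α′)(1 − θc₁(α′))⁻¹(Lʲη)²
  e^{−(1−α′)ρd}` under the located smallness `θc₁(α′) < 1`; with `θ = κ₃₈₅α₁` and `α₁ ≦ (2κ₀B₀c₁(α′))⁻¹` (`κ₀ = Λc(2c_V + κ₁ +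
  κ₂)`) the constant is `2B₀c₁(α′)` — Theorem 3.4's «positive constant α₁» witnessed on this entry for `G`, as
  `B9Thm34Ext.gpExt_entry1_explicit` did for `G′`.
* §5 (v1.1) **`gExt_leftEntry_of_386`**, `gExt_leftEntry_explicit`, `gExt_entry2_of_385_386` — the LEFT entries
  (3.42)₂ (`∇G(U′U)`, `P = Lʲη`) and (3.42)₄ (`Δ_UG(U′U)`, `P = 1`) for `G(U′U)`: multiplying the resolvent form of (3.86)
  on the left by the entry letter `X` gives the same fixed point for `X·G(U′U)`, so [4] (2.66) applies verbatim to every left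
  entry (`G′`-twin: pv21's `B6RandomWalkHom.b9_leftEntry_of_365`); the right entry (3.42)₃ and (3.43)–(3.47) stay out
  (Hölder zone).
* §6 (v1.2) **`exists_gExt_of_385`**, **`thm34_G_entry1_opForm`** — existence of `G(U′U)` on the finite lattice from
  (3.85) ((3.84) ⇒ (3.86): both resolvent identities and the two-sided inverse property for `Δ_a(U′U) = Δ_a(U) − V(A)`;
  instance of gen 2's `B9Eq360Vprime.exists_gPrimeExt_of_363`), and Theorem 3.4's `G`-part, entry (3.42)₁, with NO
  hypothesis on `G(U′U)` left: from the (3.73)/(3.77)/(3.83)-letters, Theorem 3.3's (3.42)₁,₂ for `G(U)`, `Δ_a(U)G(U) =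
  G(U)Δ_a(U) = I` ((3.27)) and the expansions (3.71)/(3.76)/(3.80) (so that `Δ_a(U′U) = B9Eq386Neumann.deltaA …′` by
  `eq384_sub`), ∃ `G(U′U)` = the two-sided inverse of `Δ_a(U′U)` with `G(U′U) ≺ B₀c₁(α′)(1 − κ₃₈₅α₁c₁(α′))⁻¹(Lʲη)²
  e^{−(1−α′)ρd}`.

SCOPE / NOT CLAIMED.  (i) OPERATOR (block `L^∞ → L^∞`) FORM throughout (cf. `B9Ineq368PPrime` (i)); the printed (3.85) IS of
this form («for b ∈ Δ(y), supp J ⊂ Δ(y′)»), (3.83)'s «|A′| restricted to the blocks defined above» likewise; the pointwise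
kernel factor `(L^{j′}η)^{−d}` of (3.77) is not used.  (ii) The decomposition `V₃ = V⁰ + V¹·∇` with the two (3.73)-sizes is the
READING of «local differential operator of the first order satisfying the bound (3.73)» ((3.70)–(3.71), (3.74)–(3.75) display
`V₁`, `V₂` as sums of terms in `A′` and in the covariant differences `D_μA′_ν`, `D*_νA′_ν`; `∇` = the letter collecting all
covariant first differences, so that (3.42)₂ is the majorant of `∇·G`); the pointwise `V₃` with explicit constants is pv27's
`B9Eq373V3`/`B9Eq382V3Operator` on the concrete carrier — the identification is the reader's.  (iii) The dressed majorants
`κ_Qe^{−δd}`, `c_Fα₁e^{−δd}` of the semi-local letters `Q`, `Q*`, `F₂`, `F₂*` and the split of the powers of `Lʲη` between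
`a` and `Q*` are modelling conventions of the homogeneous calculus (any other split is absorbed by the scale transfers).  (iv)
Rates: `ρ` is any rate with the stated margin below the COMMON input rate `δ` (the print's «½δ₀» in its re-defined-constants
convention, cf. `B9Ineq349.rates_349`, GAPS G-B9-21); §4 loses one more factor `(1−α′)` as every Neumann step of the series
does ([4] (2.66)).  (v) NOT here: the remaining entries (3.42)₂–(3.47) for `G(U′U)` («Theorem (3.3) implies also convergence
in all norms appearing in its formulation» — Hölder entries, cell GAPS G-B9-02), analyticity («Each term in the series is an
analytic function of A» = NE9 seat's `B9Eq386NeumannAnalytic`), operator-norm convergence of (3.86) (= `B9Eq386Neumann` §3–§4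
in normed rings), and any theorem of the series' end-statement.  Value = the last three asserted-routine steps of the printed
proof of Theorem 3.4 («Using the bounds … we get (3.85)», «implies in particular», «This way we get all these inequalities for
the operator G(U′U)», first inequality) kernel-checked in operator form with constants, NOT summit progress.

RELATED IN THE TREE, NOT DUPLICATED (searched 2026-08-21: `ls Balaban1983to89/ | grep -i '383\|385'` = ∅; `grep -lw
'pTwo\|vTotal'` = `B9Eq386Neumann` only; `lean search 'h385|Ineq385'` = ∅): `B9Eq386Neumann` (§2 `pTwo`/`vTotal`/`eq382`/
`eq384_factor`, §3–§5 the Neumann series (3.86) and «implies in particular» in normed rings from a NORM hypothesis `‖VG‖ ≦ cα₁`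
— §3 here supplies the block-sup form of that hypothesis from (3.85)); `B9Eq386NeumannAnalytic` (analyticity of (3.86));
`B9Thm34Ext` ((3.63)–(3.65) for `G′`: the same [4] (2.66) mechanism, USED BY NAME); `B9Eq380Telescope` ((3.80)–(3.81)
telescoping, the source of the `F₂`-letters' size); `B9Eq373V3`, `B9Eq382V3Operator` (pv27: pointwise `V₃`, (3.73));
`B9.SectBStepPrinted`/`B9.thm34_of_sectB` (the by-reference leaf in pointwise-kernel form — untouched).  None derives (3.83) or
(3.85), or feeds (3.86) into the majorant calculus.
-/

noncomputable section

namespace Literature.MathematicalPhysics.QuantumFieldTheory.Balaban1983to89.B9Ineq385VG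

open Literature.MathematicalPhysics.QuantumFieldTheory.Balaban1983to89
open Literature.MathematicalPhysics.QuantumFieldTheory.Balaban1983to89.B6RandomWalk (HasMajorant BlockSupp
  hasMajorant_mono hasMajorant_mul hasMajorant_add Triangle254 Ineq261 Ineq263 blockPiece sum_blockPiece
  blockSupp_blockPiece)
open Literature.MathematicalPhysics.QuantumFieldTheory.Balaban1983to89.B9Thm34Ext (toB6)
open Literature.MathematicalPhysics.QuantumFieldTheory.Balaban1983to89.B9Ineq347 (ScaleTransfer)
open Literature.MathematicalPhysics.QuantumFieldTheory.Balaban1983to89.B9Ineq366CPrime (hasMajorant_comp_decay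
  hasMajorant_comp_decay_left1 hasMajorant_rate_mono)
open Literature.MathematicalPhysics.QuantumFieldTheory.Balaban1983to89.B9Ineq368PPrime (hasMajorant_neg)
open Literature.MathematicalPhysics.QuantumFieldTheory.Balaban1983to89.B9Eq386Neumann (pTwo vTotal)

/-! ## §1  (3.83) for `P₂(A) = −(F₂*aQ + Q*aF₂ + F₂*aF₂)` in block-majorant (operator) form -/

section Ineq383

variable {g : B9.Geometry} [Fintype g.Site] [DecidableEq g.Site] {R : ℝ} {H : Prop} {W : Type}

/-- `P₂(A)` re-associated: `−(F₂*·(aQ) + Q*·(aF₂) + F₂*·(aF₂))` (the weight letter `a` is composed with its right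
neighbour first). [cite: Balaban1985BackgroundPropagators, (3.82) p.407] -/
theorem pTwo_assoc {S : Type*} [Ring S] (Qs Q F₂ F₂s a : S) :
    pTwo Qs Q F₂ F₂s a = -(F₂s * (a * Q) + Qs * (a * F₂) + F₂s * (a * F₂)) := by
  simp only [pTwo, mul_assoc]

/-- A DIAGONAL WEIGHT letter on the left (the `a` of `Q*aQ`, (3.24)/(3.26): multiplication of block functions by
`a_j(Lʲη)^{…}` on `Λ_j`): if `T₁` has the block-diagonal majorant `w(y)·𝟙[y = y′]` and `T₂` the majorant `K ≧ 0`, then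
`T₁T₂` has majorant `w(y)·K(y,y′)`. [cite: Balaban1985BackgroundPropagators, (3.24) p.394 + (3.26) p.395; Balaban1984PropagatorsII, (2.52) p.232] -/
theorem hasMajorant_diag_mul (blk : W → g.Site) {T₁ T₂ : Module.End ℝ (W → ℝ)} {w : g.Site → ℝ}
    {K : g.Site → g.Site → ℝ} (hK : ∀ a b, 0 ≤ K a b)
    (h₁ : HasMajorant (g := toB6 g R H) blk T₁ (fun a b : g.Site => if a = b then w a else 0))
    (h₂ : HasMajorant (g := toB6 g R H) blk T₂ K) :
    HasMajorant (g := toB6 g R H) blk (T₁ * T₂) (fun a b => w a * K a b) := by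
  refine hasMajorant_mono (g := toB6 g R H) blk (hasMajorant_mul (g := toB6 g R H) blk h₁ h₂ hK) fun a b =>
    le_of_eq ?_
  simp [ite_mul]

/-- The explicit `O(1)` of (3.83) produced here: `κ₃₈₃ = āΛc·c_F·(2κ_Q + c_Fα₁)` (`ā` the size of the weight letter `a`,
`κ_Q` of `Q`, `Q*`, `c_Fα₁` of `F₂`, `F₂*` ((3.81)), `Λ` the scale-transfer constant, `c = c₁(β)`; the three words of `P₂(A)`
contribute `c_Fκ_Q`, `κ_Qc_F`, `c_F²α₁`). [cite: Balaban1985BackgroundPropagators, (3.83) p.407] -/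
def kappa383 (κQ cF abar Λ c α₁ : ℝ) : ℝ :=
  abar * Λ * c * cF * (2 * κQ + cF * α₁)

/-- `κ₃₈₃ ≧ 0` for non-negative constants. [cite: Balaban1985BackgroundPropagators, (3.83) p.407] -/
theorem kappa383_nonneg {κQ cF abar Λ c α₁ : ℝ} (hκQ : 0 ≤ κQ) (hcF : 0 ≤ cF) (habar : 0 ≤ abar) (hΛ : 0 ≤ Λ)
    (hc : 0 ≤ c) (hα₁ : 0 ≤ α₁) : 0 ≤ kappa383 κQ cF abar Λ c α₁ := by
  unfold kappa383
  positivity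

/-- **(3.83) p. 407 — «It satisfies the bound |(P₂(A)A′)(b)| ≦ O(1)α₁(Lʲη)⁻²|A′|, b ∈ B_j(Λ_j), (3.83) with the norm |A′|
restricted to the blocks defined above» — in the block-majorant (operator) form of [4] (2.51)**, for the PRINTED `P₂(A) =
B9Eq386Neumann.pTwo Qs Q F₂ F₂s a = −(F₂*(A)aQ(U) + Q*(U)aF₂(A) + F₂*(A)aF₂(A))` («a sum of three terms obtained by the
expansion of averaging operators», (3.80) `Q(U′U) = Q(U) + F₂(A)` and its adjoint companion).  INPUTS of printed shape at a
common rate `δ`: the averaging letters `Q = Q(U)`, `Qs = Q*(U)` with majorant `κ_Qe^{−δd}` (semi-local, bounded), the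
expansion letters `F₂ = F_{2,j}(A)`, `F₂s = F*_{2,j}(A)` with majorant `c_Fα₁e^{−δd}` ((3.81) «|F_{2,j}(A)A′| ≦ O(1)α₁Q″_j|A′|»
and «F*_{2,j}(A) satisfies (3.81)»), the diagonal weight letter `a` with majorant `ā(Lʲη)⁻²𝟙[y = y′]` ((3.24)/(3.26), `ā ≧ 0`),
the scale transfer of the weight `(Lʲη)⁻²` at exponent `α` with constant `Λ ≧ 0`, (2.61) at `β`, (2.54), `d ≧ 0`.  CONCLUSION:
for `ρ ≧ 0` with `ρ + (α+β)δ₀ ≦ δ`, `P₂(A) ≺ κ₃₈₃·α₁·(Lʲη)⁻²·e^{−ρ d(y,y′)}`, i.e. `|(P₂(A)A′)(b)| ≦ κ₃₈₃α₁(Lʲη)⁻²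
e^{−ρd(y,y′)}|A′|` for `b ∈ Δ(y)`, `supp A′ ⊂ Δ(y′)` — with `κ₃₈₃` EXPLICIT (`kappa383`).
[cite: Balaban1985BackgroundPropagators, (3.82)–(3.83) p.407 + (3.80)–(3.81) p.406 + (3.24) p.394; Balaban1984PropagatorsII, Lemma 2.1 p.234 + (2.52)–(2.55) p.232] -/
theorem ineq383_op (blk : W → g.Site) (d : ℕ) (δ₀ δ α β ρ Λ κQ cF abar α₁ : ℝ)
    (hκQ : 0 ≤ κQ) (hcF : 0 ≤ cF) (habar : 0 ≤ abar) (hα₁ : 0 ≤ α₁) (hΛ : 0 ≤ Λ) (hρ : 0 ≤ ρ) (hα : 0 ≤ α)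
    (hβ : 0 ≤ β) (hδ₀ : 0 ≤ δ₀) (hr : ρ + (α + β) * δ₀ ≤ δ)
    (hdnn : ∀ a b : g.Site, 0 ≤ g.dist a b) (htri : Triangle254 (toB6 g R H))
    (h261 : Ineq261 d (toB6 g R H) δ₀ β) (hT2i : ScaleTransfer g δ₀ α Λ (fun a => (g.len a ^ 2)⁻¹))
    {Qs Q F₂ F₂s Aop : Module.End ℝ (W → ℝ)}
    (hQ : HasMajorant (g := toB6 g R H) blk Q (fun a b => κQ * Real.exp (-(δ * g.dist a b))))
    (hQs : HasMajorant (g := toB6 g R H) blk Qs (fun a b => κQ * Real.exp (-(δ * g.dist a b))))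
    (hF : HasMajorant (g := toB6 g R H) blk F₂ (fun a b => cF * α₁ * Real.exp (-(δ * g.dist a b))))
    (hFs : HasMajorant (g := toB6 g R H) blk F₂s (fun a b => cF * α₁ * Real.exp (-(δ * g.dist a b))))
    (hA : HasMajorant (g := toB6 g R H) blk Aop (fun a b : g.Site => if a = b then abar * (g.len a ^ 2)⁻¹ else 0)) :
    HasMajorant (g := toB6 g R H) blk (pTwo Qs Q F₂ F₂s Aop)
      (fun a b => kappa383 κQ cF abar Λ (B6.c1 d δ₀ β) α₁ * α₁ * (g.len a ^ 2)⁻¹ * Real.exp (-(ρ * g.dist a b))) := by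
  set c : ℝ := B6.c1 d δ₀ β with hc_def
  have hw2 : ∀ a : g.Site, 0 ≤ (g.len a ^ 2)⁻¹ := fun a => inv_nonneg.mpr (sq_nonneg _)
  have hcFα : 0 ≤ cF * α₁ := mul_nonneg hcF hα₁
  have hρδ : ρ ≤ δ := by
    have : 0 ≤ (α + β) * δ₀ := by positivity
    linarith
  -- rate-weakened right letters
  have hQρ : HasMajorant (g := toB6 g R H) blk Q (fun a b => κQ * Real.exp (-(ρ * g.dist a b))) :=
    hasMajorant_mono (g := toB6 g R H) blk hQ fun a b =>
      mul_le_mul_of_nonneg_left (Real.exp_le_exp.mpr (by nlinarith [hdnn a b])) hκQ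
  have hFρ : HasMajorant (g := toB6 g R H) blk F₂ (fun a b => cF * α₁ * Real.exp (-(ρ * g.dist a b))) :=
    hasMajorant_mono (g := toB6 g R H) blk hF fun a b =>
      mul_le_mul_of_nonneg_left (Real.exp_le_exp.mpr (by nlinarith [hdnn a b])) hcFα
  -- the weight letter composed with its right neighbour
  have hAQ : HasMajorant (g := toB6 g R H) blk (Aop * Q)
      (fun a b => (κQ * abar) * (g.len a ^ 2)⁻¹ * Real.exp (-(ρ * g.dist a b))) := by
    refine hasMajorant_mono (g := toB6 g R H) blk
      (hasMajorant_diag_mul (R := R) (H := H) blk (fun a b => mul_nonneg hκQ (Real.exp_nonneg _)) hA hQρ)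
      fun a b => le_of_eq ?_
    ring
  have hAF : HasMajorant (g := toB6 g R H) blk (Aop * F₂)
      (fun a b => (cF * α₁ * abar) * (g.len a ^ 2)⁻¹ * Real.exp (-(ρ * g.dist a b))) := by
    refine hasMajorant_mono (g := toB6 g R H) blk
      (hasMajorant_diag_mul (R := R) (H := H) blk (fun a b => mul_nonneg hcFα (Real.exp_nonneg _)) hA hFρ)
      fun a b => le_of_eq ?_
    ring
  -- the three words
  have w1 := hasMajorant_comp_decay_left1 (R := R) (H := H) blk d δ₀ α β ρ δ Λ (cF * α₁) (κQ * abar)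
    (fun a => (g.len a ^ 2)⁻¹) hw2 hΛ hcFα (mul_nonneg hκQ habar) hρ hr hdnn htri hT2i h261 hFs hAQ
  have w2 := hasMajorant_comp_decay_left1 (R := R) (H := H) blk d δ₀ α β ρ δ Λ κQ (cF * α₁ * abar)
    (fun a => (g.len a ^ 2)⁻¹) hw2 hΛ hκQ (mul_nonneg hcFα habar) hρ hr hdnn htri hT2i h261 hQs hAF
  have w3 := hasMajorant_comp_decay_left1 (R := R) (H := H) blk d δ₀ α β ρ δ Λ (cF * α₁) (cF * α₁ * abar)
    (fun a => (g.len a ^ 2)⁻¹) hw2 hΛ hcFα (mul_nonneg hcFα habar) hρ hr hdnn htri hT2i h261 hFs hAF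
  have hsum := hasMajorant_neg (R := R) (H := H) blk
    (hasMajorant_add (g := toB6 g R H) blk (hasMajorant_add (g := toB6 g R H) blk w1 w2) w3)
  rw [pTwo_assoc]
  refine hasMajorant_mono (g := toB6 g R H) blk hsum fun a b => le_of_eq ?_
  simp only [kappa383]
  ring

end Ineq383

/-! ## §2  (3.85): `V(A)G(U) ≺ O(1)α₁e^{−ρd}` from (3.73), (3.77), (3.83) and Theorem 3.3 -/

section Ineq385

variable {g : B9.Geometry} [Fintype g.Site] {R : ℝ} {H : Prop} {W : Type}

/-- The explicit `O(1)` of (3.85) produced here: `κ₃₈₅ = B₀Λc·(2c_V + κ₁ + κ₂)` (`B₀` of Theorem 3.3's (3.42)₁,₂ for `G(U)`,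
`c_V` the (3.73)-constant of `V₃`, `κ₁`, `κ₂` the (3.77)/(3.83)-constants of `P₁`, `P₂`, `Λ` the scale-transfer constant, `c =
c₁(β)`). [cite: Balaban1985BackgroundPropagators, (3.85) p.407] -/
def kappa385 (B₀ cV κ₁ κ₂ Λ c : ℝ) : ℝ :=
  B₀ * Λ * c * (2 * cV + κ₁ + κ₂)

/-- `κ₃₈₅ ≧ 0` for non-negative constants. [cite: Balaban1985BackgroundPropagators, (3.85) p.407] -/
theorem kappa385_nonneg {B₀ cV κ₁ κ₂ Λ c : ℝ} (hB₀ : 0 ≤ B₀) (hcV : 0 ≤ cV) (hκ₁ : 0 ≤ κ₁) (hκ₂ : 0 ≤ κ₂)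
    (hΛ : 0 ≤ Λ) (hc : 0 ≤ c) : 0 ≤ kappa385 B₀ cV κ₁ κ₂ Λ c := by
  unfold kappa385
  positivity

/-- **(3.85) p. 407 — «Using the bounds (3.73), (3.77), (3.83) and assuming that Theorem 3.3 holds for G(U), we get
|(V(A)G(U)J)(b)| ≦ O(1)α₁e^{−(1/2)δ₀d(y,y′)}|J| for b ∈ Δ(y), supp J ⊂ Δ(y′)» — in the block-majorant form of [4] (2.51)
(which IS the printed shape here).**  LETTERS: `V = V(A) = B9Eq386Neumann.vTotal V₃ P₁ P₂ = V₃ + P₁ + P₂` ((3.84)); `V₃ =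
V⁰ + V¹·∇` — «a local differential operator of the first order satisfying the bound (3.73)»: `V⁰ ≺ c_Vα₁(Lʲη)⁻²e^{−δd}`,
`V¹ ≺ c_Vα₁(Lʲη)⁻¹e^{−δd}` (`∇` = the letter of all covariant first differences defined by `U`); `P₁ ≺ κ₁α₁(Lʲη)⁻²e^{−δd}`
((3.77), `B9Ineq377POne.ineq377_op`); `P₂ ≺ κ₂α₁(Lʲη)⁻²e^{−δd}` ((3.83), `ineq383_op`); «Theorem 3.3 holds for G(U)»:
(3.42)₁ `G ≺ B₀(Lʲη)²e^{−δd}` and (3.42)₂ `∇G ≺ B₀Lʲη e^{−δd}` (majorant of the product `∇·G`); Lemma 2.1 of [4]: the scale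
transfers of the weights `Lʲη`, `(Lʲη)²` at exponent `α` with constant `Λ ≧ 0`, (2.61) at `β`, (2.54), `d ≧ 0`, `Lʲη > 0`.
CONCLUSION: for `ρ ≧ 0` with `ρ + (α+β)δ₀ ≦ δ`, `V(A)G(U) ≺ κ₃₈₅·α₁·e^{−ρ d(y,y′)}` with `κ₃₈₅ = B₀Λc(2c_V + κ₁ + κ₂)`
EXPLICIT — the four words `V⁰G`, `V¹(∇G)`, `P₁G`, `P₂G`, one composition each.
[cite: Balaban1985BackgroundPropagators, (3.84)–(3.85) p.407 + (3.73) p.405 + (3.77) p.406 + (3.83) p.407 + Thm 3.3 p.399 + (3.42) p.397; Balaban1984PropagatorsII, Lemma 2.1 p.234 + (2.52)–(2.55) p.232] -/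
theorem ineq385_op (blk : W → g.Site) (d : ℕ) (δ₀ δ α β ρ Λ B₀ cV κ₁ κ₂ α₁ : ℝ)
    (hB₀ : 0 ≤ B₀) (hcV : 0 ≤ cV) (hκ₁ : 0 ≤ κ₁) (hκ₂ : 0 ≤ κ₂) (hα₁ : 0 ≤ α₁) (hΛ : 0 ≤ Λ) (hρ : 0 ≤ ρ)
    (hα : 0 ≤ α) (hβ : 0 ≤ β) (hδ₀ : 0 ≤ δ₀) (hr : ρ + (α + β) * δ₀ ≤ δ)
    (hdnn : ∀ a b : g.Site, 0 ≤ g.dist a b) (htri : Triangle254 (toB6 g R H)) (hlen : ∀ y : g.Site, 0 < g.len y)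
    (h261 : Ineq261 d (toB6 g R H) δ₀ β)
    (hT1 : ScaleTransfer g δ₀ α Λ (fun a => g.len a)) (hT2 : ScaleTransfer g δ₀ α Λ (fun a => g.len a ^ 2))
    {G D V₃ V0 V1 P₁ P₂ : Module.End ℝ (W → ℝ)} (hV₃ : V₃ = V0 + V1 * D)
    (hV0 : HasMajorant (g := toB6 g R H) blk V0
      (fun a b => cV * α₁ * (g.len a ^ 2)⁻¹ * Real.exp (-(δ * g.dist a b))))
    (hV1 : HasMajorant (g := toB6 g R H) blk V1 (fun a b => cV * α₁ * (g.len a)⁻¹ * Real.exp (-(δ * g.dist a b))))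
    (hP₁ : HasMajorant (g := toB6 g R H) blk P₁ (fun a b => κ₁ * α₁ * (g.len a ^ 2)⁻¹ * Real.exp (-(δ * g.dist a b))))
    (hP₂ : HasMajorant (g := toB6 g R H) blk P₂ (fun a b => κ₂ * α₁ * (g.len a ^ 2)⁻¹ * Real.exp (-(δ * g.dist a b))))
    (hG : HasMajorant (g := toB6 g R H) blk G (fun a b => B₀ * g.len a ^ 2 * Real.exp (-(δ * g.dist a b))))
    (hDG : HasMajorant (g := toB6 g R H) blk (D * G) (fun a b => B₀ * g.len a * Real.exp (-(δ * g.dist a b)))) :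
    HasMajorant (g := toB6 g R H) blk (vTotal V₃ P₁ P₂ * G)
      (fun a b => kappa385 B₀ cV κ₁ κ₂ Λ (B6.c1 d δ₀ β) * α₁ * Real.exp (-(ρ * g.dist a b))) := by
  set c : ℝ := B6.c1 d δ₀ β with hc_def
  have hw1 : ∀ a : g.Site, 0 ≤ g.len a := fun a => (hlen a).le
  have hw2 : ∀ a : g.Site, 0 ≤ g.len a ^ 2 := fun a => sq_nonneg _
  have hw1i : ∀ a : g.Site, 0 ≤ (g.len a)⁻¹ := fun a => inv_nonneg.mpr (hlen a).le
  have hw2i : ∀ a : g.Site, 0 ≤ (g.len a ^ 2)⁻¹ := fun a => inv_nonneg.mpr (sq_nonneg _)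
  have hcVα : 0 ≤ cV * α₁ := mul_nonneg hcV hα₁
  have hκ₁α : 0 ≤ κ₁ * α₁ := mul_nonneg hκ₁ hα₁
  have hκ₂α : 0 ≤ κ₂ * α₁ := mul_nonneg hκ₂ hα₁
  have hρδ : ρ ≤ δ := by
    have : 0 ≤ (α + β) * δ₀ := by positivity
    linarith
  -- rate-weakened right letters
  have hGρ := hasMajorant_rate_mono (R := R) (H := H) blk B₀ (fun a => g.len a ^ 2) hB₀ hw2 hρδ hdnn hG
  have hDGρ := hasMajorant_rate_mono (R := R) (H := H) blk B₀ (fun a => g.len a) hB₀ hw1 hρδ hdnn hDG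
  -- the four words
  have w1 := hasMajorant_comp_decay (R := R) (H := H) blk d δ₀ α β ρ δ Λ (cV * α₁) B₀ (fun a => (g.len a ^ 2)⁻¹)
    (fun a => g.len a ^ 2) hw2i hw2 hΛ hcVα hB₀ hρ hr hdnn htri hT2 h261 hV0 hGρ
  have w2 := hasMajorant_comp_decay (R := R) (H := H) blk d δ₀ α β ρ δ Λ (cV * α₁) B₀ (fun a => (g.len a)⁻¹)
    (fun a => g.len a) hw1i hw1 hΛ hcVα hB₀ hρ hr hdnn htri hT1 h261 hV1 hDGρ
  have w3 := hasMajorant_comp_decay (R := R) (H := H) blk d δ₀ α β ρ δ Λ (κ₁ * α₁) B₀ (fun a => (g.len a ^ 2)⁻¹)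
    (fun a => g.len a ^ 2) hw2i hw2 hΛ hκ₁α hB₀ hρ hr hdnn htri hT2 h261 hP₁ hGρ
  have w4 := hasMajorant_comp_decay (R := R) (H := H) blk d δ₀ α β ρ δ Λ (κ₂ * α₁) B₀ (fun a => (g.len a ^ 2)⁻¹)
    (fun a => g.len a ^ 2) hw2i hw2 hΛ hκ₂α hB₀ hρ hr hdnn htri hT2 h261 hP₂ hGρ
  have hsum := hasMajorant_add (g := toB6 g R H) blk
    (hasMajorant_add (g := toB6 g R H) blk (hasMajorant_add (g := toB6 g R H) blk w1 w2) w3) w4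
  have e : vTotal V₃ P₁ P₂ * G = V0 * G + V1 * (D * G) + P₁ * G + P₂ * G := by
    rw [vTotal, hV₃]
    noncomm_ring
  rw [e]
  refine hasMajorant_mono (g := toB6 g R H) blk hsum fun a b => le_of_eq ?_
  have ha : g.len a ≠ 0 := (hlen a).ne'
  simp only [kappa385]
  field_simp
  ring

end Ineq385

/-! ## §3  «This bound implies in particular the bound |V(A)G(U)J| ≦ O(1)α₁|J|» — supremum norm from a block majorant -/

section SupNorm

variable {g : B9.Geometry} [Fintype g.Site] {R : ℝ} {H : Prop} {W : Type}

/-- **From a (2.51)-majorant to a supremum-norm bound**: if `T` has the majorant `K` and `|μ| ≦ B` everywhere (no support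
condition), then `|(Tμ)(x)| ≦ (Σ_{y′∈𝔅} K(y,y′))·B` for `x ∈ Δ(y)` — decompose `μ = Σ_{y′} Δ(y′)μ` ([4] (2.52)) and add the
block bounds. [cite: Balaban1984PropagatorsII, (2.51)–(2.52) p.232; Balaban1985BackgroundPropagators, p.407 after (3.85)] -/
theorem supBound_of_hasMajorant (blk : W → g.Site) {T : Module.End ℝ (W → ℝ)} {K : g.Site → g.Site → ℝ}
    (h : HasMajorant (g := toB6 g R H) blk T K) (μ : W → ℝ) (B : ℝ) (hB : 0 ≤ B)
    (hμ : ∀ x, |μ x| ≤ B) (x : W) : |T μ x| ≤ (∑ y' : g.Site, K (blk x) y') * B := by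
  classical
  have hpiece : ∀ y' : g.Site, |T (blockPiece (g := toB6 g R H) blk y' μ) x| ≤ K (blk x) y' * B := fun y' =>
    h y' _ _ (blockSupp_blockPiece (g := toB6 g R H) blk μ y' B hB (fun x' _ => hμ x')) x
  have hdec : T μ x = ∑ y' : g.Site, T (blockPiece (g := toB6 g R H) blk y' μ) x := by
    conv_lhs => rw [← sum_blockPiece (g := toB6 g R H) blk μ]
    rw [map_sum, Finset.sum_apply]
    rfl
  rw [hdec, Finset.sum_mul]
  exact (Finset.abs_sum_le_sum_abs _ _).trans (Finset.sum_le_sum fun y' _ => hpiece y')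

/-- **«This bound implies in particular the bound |V(A)G(U)J| ≦ O(1)α₁|J|, hence V(A)G(U) is a small operator in supremum
norm»** (p. 407): a majorant `θ·e^{−ρd(y,y′)}` (`θ ≧ 0`, e.g. `θ = κ₃₈₅α₁` of `ineq385_op`) and the row-sum bound
`Σ_{y′}e^{−ρd(y,y′)} ≦ C_ρ` (Lemma 2.1 (2.61) of [4] at the rate `ρ`) give `|(Tμ)(x)| ≦ θC_ρ·sup|μ|` for every bounded `μ`.
[cite: Balaban1985BackgroundPropagators, p.407 after (3.85); Balaban1984PropagatorsII, (2.61) p.234] -/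
theorem supNorm_VG_le (blk : W → g.Site) (θ ρ Cρ : ℝ) (hθ : 0 ≤ θ)
    (hsum : ∀ y : g.Site, ∑ y' : g.Site, Real.exp (-(ρ * g.dist y y')) ≤ Cρ)
    {T : Module.End ℝ (W → ℝ)}
    (h : HasMajorant (g := toB6 g R H) blk T (fun a b => θ * Real.exp (-(ρ * g.dist a b))))
    (μ : W → ℝ) (B : ℝ) (hB : 0 ≤ B) (hμ : ∀ x, |μ x| ≤ B) (x : W) : |T μ x| ≤ θ * Cρ * B := by
  have h1 := supBound_of_hasMajorant (R := R) (H := H) blk h μ B hB hμ x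
  refine h1.trans (mul_le_mul_of_nonneg_right ?_ hB)
  rw [← Finset.mul_sum]
  exact mul_le_mul_of_nonneg_left (hsum (blk x)) hθ

/-- The row-sum hypothesis of `supNorm_VG_le` in the form of [4] Lemma 2.1 (2.61) transported by `toB6`: at the rate `ρ =
γδ₀`, `C_ρ = c₁(γ)`. [cite: Balaban1984PropagatorsII, (2.61) p.234] -/
theorem rowSum_of_ineq261 (d : ℕ) (δ₀ γ : ℝ) (h261 : Ineq261 d (toB6 g R H) δ₀ γ) (y : g.Site) :
    ∑ y' : g.Site, Real.exp (-(γ * δ₀ * g.dist y y')) ≤ B6.c1 d δ₀ γ :=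
  h261 y

end SupNorm

/-! ## §4  (3.86) ⇒ the first inequality of Theorem 3.3 for `G(U′U)` -/

section Eq386

variable {g : B9.Geometry} [Fintype g.Site] {R : ℝ} {H : Prop} {W : Type} [Fintype W] [DecidableEq W]

/-- **(3.86) ⇒ (3.42)₁ for `G(U′U)`, constants explicit** — «G(U′U) = G(U)(I − V(A)G(U))⁻¹ = Σ_{n=0}^∞ G(U)(V(A)G(U))ⁿ, (3.86)
… This way we get all these inequalities for the operator G(U′U)», FIRST inequality: from the resolvent form `G(U′U) = G(U) +
G(U′U)·(V(A)G(U))` of (3.86) (`h386`), Theorem 3.3's `G(U) ≺ B₀P(y)e^{−ρd}` (`P(y) = (Lʲη)²`, any `P ≧ 0`), the (3.85)-majorant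
`V(A)G(U) ≺ θe^{−ρd}` (`ineq385_op`: `θ = κ₃₈₅α₁`), Lemma 2.1 of [4] at the rate `ρ` with exponent `α′` ((2.61), hence (2.63))
and the located smallness `θc₁(α′) < 1` («for α₁ sufficiently mall» [sic]): `G(U′U) ≺ B₀c₁(α′)(1 − θc₁(α′))⁻¹P(y)
e^{−(1−α′)ρ d(y,y′)}`.  This is [4] (2.66) = `B9Thm34Ext.gpExt_entry1_of_365` with `G`, `V(A)G(U)` for `G′`, `V′(A)G′(U)`.
[cite: Balaban1985BackgroundPropagators, (3.85)–(3.86) p.407 + Thm 3.3 p.399; Balaban1984PropagatorsII, (2.66) p.234 + Lemma 2.1 p.234] -/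
theorem gExt_entry1_of_386 (blk : W → g.Site) (d : ℕ) (ρ α' θ B₀ : ℝ) (P : g.Site → ℝ)
    (hB₀ : 0 ≤ B₀) (hP : ∀ y, 0 ≤ P y) (hθ : 0 ≤ θ) (hρ : 0 ≤ ρ) (hα' : α' ≤ 1) (hα'ρ : 0 ≤ (1 - α') * ρ)
    (htri : Triangle254 (toB6 g R H)) (hrefl : ∀ y : g.Site, g.dist y y = 0)
    (hdnn : ∀ y y' : g.Site, 0 ≤ g.dist y y') (h261 : Ineq261 d (toB6 g R H) ρ α')
    (hsmall : θ * B6.c1 d ρ α' < 1)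
    {GU GExt VG : Module.End ℝ (W → ℝ)}
    (h342 : HasMajorant (g := toB6 g R H) blk GU (fun a b => B₀ * P a * Real.exp (-(ρ * g.dist a b))))
    (h385 : HasMajorant (g := toB6 g R H) blk VG (fun a b => θ * Real.exp (-(ρ * g.dist a b))))
    (h386 : GExt = GU + GExt * VG) :
    HasMajorant (g := toB6 g R H) blk GExt
      (fun a b => B₀ * B6.c1 d ρ α' * (1 - θ * B6.c1 d ρ α')⁻¹ * P a * Real.exp (-((1 - α') * ρ * g.dist a b))) :=
  B9Thm34Ext.gpExt_entry1_of_365 (R := R) (H := H) blk d ρ α' θ B₀ P hB₀ hP hθ hα'ρ htri hrefl hdnn h261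
    (B9Thm34Ext.h263_of_h261 g R H d ρ α' htri hρ hα' h261) hsmall h342 h385 h386

/-- **Theorem 3.4's «positive constant α₁» witnessed on the `G`-entry**: with `θ = κ₀B₀α₁` (`κ₀B₀ = κ₃₈₅`, i.e. `κ₀ =
Λc(2c_V + κ₁ + κ₂)`) and the EXPLICIT threshold `α₁ ≦ (2κ₀B₀c₁(α′))⁻¹`, `G(U′U)` obeys (3.42)₁ with constant `2B₀c₁(α′)` and
rate `(1−α′)ρ`.  Instance of `B9Thm34Ext.gpExt_entry1_explicit`. [cite: Balaban1985BackgroundPropagators, Thm 3.4 p.400 + (3.85)–(3.86) p.407] -/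
theorem gExt_entry1_explicit (blk : W → g.Site) (d : ℕ) (ρ α' κ₀ B₀ α₁ : ℝ) (P : g.Site → ℝ)
    (hB₀ : 0 < B₀) (hκ₀ : 0 < κ₀) (hα₁ : 0 ≤ α₁) (hP : ∀ y, 0 ≤ P y) (hρ : 0 ≤ ρ) (hα' : α' ≤ 1)
    (hα'ρ : 0 ≤ (1 - α') * ρ) (hc₁ : 0 < B6.c1 d ρ α')
    (htri : Triangle254 (toB6 g R H)) (hrefl : ∀ y : g.Site, g.dist y y = 0)
    (hdnn : ∀ y y' : g.Site, 0 ≤ g.dist y y') (h261 : Ineq261 d (toB6 g R H) ρ α')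
    (ha₁ : α₁ ≤ (2 * κ₀ * B₀ * B6.c1 d ρ α')⁻¹)
    {GU GExt VG : Module.End ℝ (W → ℝ)}
    (h342 : HasMajorant (g := toB6 g R H) blk GU (fun a b => B₀ * P a * Real.exp (-(ρ * g.dist a b))))
    (h385 : HasMajorant (g := toB6 g R H) blk VG (fun a b => κ₀ * B₀ * α₁ * Real.exp (-(ρ * g.dist a b))))
    (h386 : GExt = GU + GExt * VG) :
    HasMajorant (g := toB6 g R H) blk GExt
      (fun a b => 2 * B₀ * B6.c1 d ρ α' * P a * Real.exp (-((1 - α') * ρ * g.dist a b))) :=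
  B9Thm34Ext.gpExt_entry1_explicit (R := R) (H := H) blk d ρ α' κ₀ B₀ α₁ P hB₀ hκ₀ hα₁ hP hα'ρ hc₁ htri hrefl hdnn h261
    (B9Thm34Ext.h263_of_h261 g R H d ρ α' htri hρ hα' h261) ha₁ h342 h385 h386

/-- **The chain (3.85) ⇒ (3.86) ⇒ (3.42)₁ for `G(U′U)` assembled**: the hypotheses of `ineq385_op` (inputs at the common
rate `δ`, output rate `ρ`), `G(U)`'s (3.42)₁-majorant, Lemma 2.1 at `(ρ, α′)` and the located smallness
`κ₃₈₅α₁c₁(α′) < 1` give `G(U′U) ≺ B₀c₁(α′)(1 − κ₃₈₅α₁c₁(α′))⁻¹(Lʲη)²e^{−(1−α′)ρd}`.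
[cite: Balaban1985BackgroundPropagators, (3.84)–(3.86) p.407 + Thm 3.3 p.399; Balaban1984PropagatorsII, (2.66) p.234] -/
theorem gExt_entry1_of_385_386 (blk : W → g.Site) (d : ℕ) (δ₀ δ α β ρ α' Λ B₀ cV κ₁ κ₂ α₁ : ℝ)
    (hB₀ : 0 ≤ B₀) (hcV : 0 ≤ cV) (hκ₁ : 0 ≤ κ₁) (hκ₂ : 0 ≤ κ₂) (hα₁ : 0 ≤ α₁) (hΛ : 0 ≤ Λ) (hρ : 0 ≤ ρ)
    (hα : 0 ≤ α) (hβ : 0 ≤ β) (hδ₀ : 0 ≤ δ₀) (hr : ρ + (α + β) * δ₀ ≤ δ) (hα' : α' ≤ 1)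
    (hα'ρ : 0 ≤ (1 - α') * ρ)
    (hdnn : ∀ a b : g.Site, 0 ≤ g.dist a b) (htri : Triangle254 (toB6 g R H)) (hrefl : ∀ y : g.Site, g.dist y y = 0)
    (hlen : ∀ y : g.Site, 0 < g.len y) (h261 : Ineq261 d (toB6 g R H) δ₀ β) (h261' : Ineq261 d (toB6 g R H) ρ α')
    (hT1 : ScaleTransfer g δ₀ α Λ (fun a => g.len a)) (hT2 : ScaleTransfer g δ₀ α Λ (fun a => g.len a ^ 2))
    (hsmall : kappa385 B₀ cV κ₁ κ₂ Λ (B6.c1 d δ₀ β) * α₁ * B6.c1 d ρ α' < 1)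
    {G GExt D V₃ V0 V1 P₁ P₂ : Module.End ℝ (W → ℝ)} (hV₃ : V₃ = V0 + V1 * D)
    (hV0 : HasMajorant (g := toB6 g R H) blk V0
      (fun a b => cV * α₁ * (g.len a ^ 2)⁻¹ * Real.exp (-(δ * g.dist a b))))
    (hV1 : HasMajorant (g := toB6 g R H) blk V1 (fun a b => cV * α₁ * (g.len a)⁻¹ * Real.exp (-(δ * g.dist a b))))
    (hP₁ : HasMajorant (g := toB6 g R H) blk P₁ (fun a b => κ₁ * α₁ * (g.len a ^ 2)⁻¹ * Real.exp (-(δ * g.dist a b))))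
    (hP₂ : HasMajorant (g := toB6 g R H) blk P₂ (fun a b => κ₂ * α₁ * (g.len a ^ 2)⁻¹ * Real.exp (-(δ * g.dist a b))))
    (hG : HasMajorant (g := toB6 g R H) blk G (fun a b => B₀ * g.len a ^ 2 * Real.exp (-(δ * g.dist a b))))
    (hDG : HasMajorant (g := toB6 g R H) blk (D * G) (fun a b => B₀ * g.len a * Real.exp (-(δ * g.dist a b))))
    (h386 : GExt = G + GExt * (vTotal V₃ P₁ P₂ * G)) :
    HasMajorant (g := toB6 g R H) blk GExt
      (fun a b => B₀ * B6.c1 d ρ α' * (1 - kappa385 B₀ cV κ₁ κ₂ Λ (B6.c1 d δ₀ β) * α₁ * B6.c1 d ρ α')⁻¹ *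
        g.len a ^ 2 * Real.exp (-((1 - α') * ρ * g.dist a b))) := by
  have h385 := ineq385_op (R := R) (H := H) blk d δ₀ δ α β ρ Λ B₀ cV κ₁ κ₂ α₁ hB₀ hcV hκ₁ hκ₂ hα₁ hΛ hρ hα hβ hδ₀ hr
    hdnn htri hlen h261 hT1 hT2 hV₃ hV0 hV1 hP₁ hP₂ hG hDG
  have hρδ : ρ ≤ δ := by
    have : 0 ≤ (α + β) * δ₀ := by positivity
    linarith
  have hGρ := hasMajorant_rate_mono (R := R) (H := H) blk B₀ (fun a => g.len a ^ 2) hB₀ (fun a => sq_nonneg _) hρδ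
    hdnn hG
  have hθ : 0 ≤ kappa385 B₀ cV κ₁ κ₂ Λ (B6.c1 d δ₀ β) * α₁ :=
    mul_nonneg (kappa385_nonneg hB₀ hcV hκ₁ hκ₂ hΛ (B6RandomWalk.c1_nonneg d δ₀ β)) hα₁
  exact gExt_entry1_of_386 (R := R) (H := H) blk d ρ α' _ B₀ (fun a => g.len a ^ 2) hB₀ (fun a => sq_nonneg _) hθ hρ
    hα' hα'ρ htri hrefl hdnn h261' hsmall hGρ h385 h386

end Eq386

/-! ## §5  (v1.1) The LEFT entries (3.42)₂, (3.42)₄ of Theorem 3.3 for `G(U′U)` — «This way we get all these inequalities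
for the operator G(U′U)» (p. 407), every entry with the derivative letter on the LEFT -/

section LeftEntries

variable {g : B9.Geometry} [Fintype g.Site] {R : ℝ} {H : Prop} {W : Type} [Fintype W] [DecidableEq W]

/-- **(3.86) ⇒ (3.42)_X for `G(U′U)`, every LEFT entry `X`** (`X = ∇_U`: (3.42)₂ with `P(y) = Lʲη`; `X = Δ_U`: (3.42)₄
with `P = 1`; `X = 1`: (3.42)₁ = `gExt_entry1_of_386`) — «This way we get all these inequalities for the operator G(U′U)»,
left entries: multiplying the resolvent form `G(U′U) = G(U) + G(U′U)·V(A)G(U)` of (3.86) on the left by `X` gives the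
fixed point `X·G(U′U) = X·G(U) + (X·G(U′U))·(V(A)G(U))`, to which [4] (2.66) (`B9Thm34Ext.gpExt_entry1_of_365`) applies
verbatim: from Theorem 3.3's `X·G(U) ≺ B₀P(y)e^{−ρd}` and (3.85) `V(A)G(U) ≺ θe^{−ρd}`, Lemma 2.1 of [4] at `(ρ, α′)` and the
located smallness `θc₁(α′) < 1`: `X·G(U′U) ≺ B₀c₁(α′)(1 − θc₁(α′))⁻¹P(y)e^{−(1−α′)ρ d(y,y′)}`.  The `G′`-twin is pv21's
`B6RandomWalkHom.b9_leftEntry_of_365`.  NOT here: the RIGHT entry (3.42)₃ `G(U′U)∇*_U` (the right-routed series ends in the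
mixed kernel `∇G∇*` of (3.44), cell GAPS G-B9-02; pv21's all-left route `b9_rightEntry_of_365_divForm` is the `G′` model) and
the Hölder / L² / global entries (3.43)–(3.47).
[cite: Balaban1985BackgroundPropagators, (3.86) p.407 + Thm 3.3 p.399 + (3.42) p.397; Balaban1984PropagatorsII, (2.66) p.234 + Lemma 2.1 p.234] -/
theorem gExt_leftEntry_of_386 (blk : W → g.Site) (d : ℕ) (ρ α' θ B₀ : ℝ) (P : g.Site → ℝ)
    (hB₀ : 0 ≤ B₀) (hP : ∀ y, 0 ≤ P y) (hθ : 0 ≤ θ) (hρ : 0 ≤ ρ) (hα' : α' ≤ 1) (hα'ρ : 0 ≤ (1 - α') * ρ)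
    (htri : Triangle254 (toB6 g R H)) (hrefl : ∀ y : g.Site, g.dist y y = 0)
    (hdnn : ∀ y y' : g.Site, 0 ≤ g.dist y y') (h261 : Ineq261 d (toB6 g R H) ρ α')
    (hsmall : θ * B6.c1 d ρ α' < 1)
    {X GU GExt VG : Module.End ℝ (W → ℝ)}
    (h342X : HasMajorant (g := toB6 g R H) blk (X * GU) (fun a b => B₀ * P a * Real.exp (-(ρ * g.dist a b))))
    (h385 : HasMajorant (g := toB6 g R H) blk VG (fun a b => θ * Real.exp (-(ρ * g.dist a b))))
    (h386 : GExt = GU + GExt * VG) :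
    HasMajorant (g := toB6 g R H) blk (X * GExt)
      (fun a b => B₀ * B6.c1 d ρ α' * (1 - θ * B6.c1 d ρ α')⁻¹ * P a * Real.exp (-((1 - α') * ρ * g.dist a b))) := by
  have hfix : X * GExt = X * GU + X * GExt * VG := by
    conv_lhs => rw [h386]
    rw [mul_add, ← mul_assoc]
  exact gExt_entry1_of_386 (R := R) (H := H) blk d ρ α' θ B₀ P hB₀ hP hθ hρ hα' hα'ρ htri hrefl hdnn h261 hsmall h342X
    h385 hfix

/-- **The left entries with Theorem 3.4's explicit threshold**: `θ = κ₀B₀α₁` (`κ₀B₀ = κ₃₈₅`), `α₁ ≦ (2κ₀B₀c₁(α′))⁻¹` ⟹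
`X·G(U′U) ≺ 2B₀c₁(α′)P(y)e^{−(1−α′)ρd}` for every left entry `X` with `X·G(U) ≺ B₀P(y)e^{−ρd}` ((3.42)₂: `P = Lʲη`;
(3.42)₄: `P = 1`). [cite: Balaban1985BackgroundPropagators, Thm 3.4 p.400 + (3.86) p.407 + (3.42) p.397] -/
theorem gExt_leftEntry_explicit (blk : W → g.Site) (d : ℕ) (ρ α' κ₀ B₀ α₁ : ℝ) (P : g.Site → ℝ)
    (hB₀ : 0 < B₀) (hκ₀ : 0 < κ₀) (hα₁ : 0 ≤ α₁) (hP : ∀ y, 0 ≤ P y) (hρ : 0 ≤ ρ) (hα' : α' ≤ 1)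
    (hα'ρ : 0 ≤ (1 - α') * ρ) (hc₁ : 0 < B6.c1 d ρ α')
    (htri : Triangle254 (toB6 g R H)) (hrefl : ∀ y : g.Site, g.dist y y = 0)
    (hdnn : ∀ y y' : g.Site, 0 ≤ g.dist y y') (h261 : Ineq261 d (toB6 g R H) ρ α')
    (ha₁ : α₁ ≤ (2 * κ₀ * B₀ * B6.c1 d ρ α')⁻¹)
    {X GU GExt VG : Module.End ℝ (W → ℝ)}
    (h342X : HasMajorant (g := toB6 g R H) blk (X * GU) (fun a b => B₀ * P a * Real.exp (-(ρ * g.dist a b))))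
    (h385 : HasMajorant (g := toB6 g R H) blk VG (fun a b => κ₀ * B₀ * α₁ * Real.exp (-(ρ * g.dist a b))))
    (h386 : GExt = GU + GExt * VG) :
    HasMajorant (g := toB6 g R H) blk (X * GExt)
      (fun a b => 2 * B₀ * B6.c1 d ρ α' * P a * Real.exp (-((1 - α') * ρ * g.dist a b))) := by
  have hfix : X * GExt = X * GU + X * GExt * VG := by
    conv_lhs => rw [h386]
    rw [mul_add, ← mul_assoc]
  exact gExt_entry1_explicit (R := R) (H := H) blk d ρ α' κ₀ B₀ α₁ P hB₀ hκ₀ hα₁ hP hρ hα' hα'ρ hc₁ htri hrefl hdnn h261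
    ha₁ h342X h385 hfix

/-- **(3.42)₂ for `G(U′U)` assembled from the `ineq385_op` hypotheses**: with `∇G(U) ≺ B₀Lʲη e^{−δd}` (Theorem 3.3 (3.42)₂,
the same hypothesis `hDG` that feeds `V¹·∇G` in (3.85)) and the located smallness `κ₃₈₅α₁c₁(α′) < 1`:
`∇G(U′U) ≺ B₀c₁(α′)(1 − κ₃₈₅α₁c₁(α′))⁻¹Lʲη e^{−(1−α′)ρd}`.
[cite: Balaban1985BackgroundPropagators, (3.84)–(3.86) p.407 + Thm 3.3 p.399 + (3.42) p.397; Balaban1984PropagatorsII, (2.66) p.234] -/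
theorem gExt_entry2_of_385_386 (blk : W → g.Site) (d : ℕ) (δ₀ δ α β ρ α' Λ B₀ cV κ₁ κ₂ α₁ : ℝ)
    (hB₀ : 0 ≤ B₀) (hcV : 0 ≤ cV) (hκ₁ : 0 ≤ κ₁) (hκ₂ : 0 ≤ κ₂) (hα₁ : 0 ≤ α₁) (hΛ : 0 ≤ Λ) (hρ : 0 ≤ ρ)
    (hα : 0 ≤ α) (hβ : 0 ≤ β) (hδ₀ : 0 ≤ δ₀) (hr : ρ + (α + β) * δ₀ ≤ δ) (hα' : α' ≤ 1)
    (hα'ρ : 0 ≤ (1 - α') * ρ)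
    (hdnn : ∀ a b : g.Site, 0 ≤ g.dist a b) (htri : Triangle254 (toB6 g R H)) (hrefl : ∀ y : g.Site, g.dist y y = 0)
    (hlen : ∀ y : g.Site, 0 < g.len y) (h261 : Ineq261 d (toB6 g R H) δ₀ β) (h261' : Ineq261 d (toB6 g R H) ρ α')
    (hT1 : ScaleTransfer g δ₀ α Λ (fun a => g.len a)) (hT2 : ScaleTransfer g δ₀ α Λ (fun a => g.len a ^ 2))
    (hsmall : kappa385 B₀ cV κ₁ κ₂ Λ (B6.c1 d δ₀ β) * α₁ * B6.c1 d ρ α' < 1)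
    {G GExt D V₃ V0 V1 P₁ P₂ : Module.End ℝ (W → ℝ)} (hV₃ : V₃ = V0 + V1 * D)
    (hV0 : HasMajorant (g := toB6 g R H) blk V0
      (fun a b => cV * α₁ * (g.len a ^ 2)⁻¹ * Real.exp (-(δ * g.dist a b))))
    (hV1 : HasMajorant (g := toB6 g R H) blk V1 (fun a b => cV * α₁ * (g.len a)⁻¹ * Real.exp (-(δ * g.dist a b))))
    (hP₁ : HasMajorant (g := toB6 g R H) blk P₁ (fun a b => κ₁ * α₁ * (g.len a ^ 2)⁻¹ * Real.exp (-(δ * g.dist a b))))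
    (hP₂ : HasMajorant (g := toB6 g R H) blk P₂ (fun a b => κ₂ * α₁ * (g.len a ^ 2)⁻¹ * Real.exp (-(δ * g.dist a b))))
    (hG : HasMajorant (g := toB6 g R H) blk G (fun a b => B₀ * g.len a ^ 2 * Real.exp (-(δ * g.dist a b))))
    (hDG : HasMajorant (g := toB6 g R H) blk (D * G) (fun a b => B₀ * g.len a * Real.exp (-(δ * g.dist a b))))
    (h386 : GExt = G + GExt * (vTotal V₃ P₁ P₂ * G)) :
    HasMajorant (g := toB6 g R H) blk (D * GExt)
      (fun a b => B₀ * B6.c1 d ρ α' * (1 - kappa385 B₀ cV κ₁ κ₂ Λ (B6.c1 d δ₀ β) * α₁ * B6.c1 d ρ α')⁻¹ *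
        g.len a * Real.exp (-((1 - α') * ρ * g.dist a b))) := by
  have h385 := ineq385_op (R := R) (H := H) blk d δ₀ δ α β ρ Λ B₀ cV κ₁ κ₂ α₁ hB₀ hcV hκ₁ hκ₂ hα₁ hΛ hρ hα hβ hδ₀ hr
    hdnn htri hlen h261 hT1 hT2 hV₃ hV0 hV1 hP₁ hP₂ hG hDG
  have hρδ : ρ ≤ δ := by
    have : 0 ≤ (α + β) * δ₀ := by positivity
    linarith
  have hDGρ := hasMajorant_rate_mono (R := R) (H := H) blk B₀ (fun a => g.len a) hB₀ (fun a => (hlen a).le) hρδ hdnn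
    hDG
  have hθ : 0 ≤ kappa385 B₀ cV κ₁ κ₂ Λ (B6.c1 d δ₀ β) * α₁ :=
    mul_nonneg (kappa385_nonneg hB₀ hcV hκ₁ hκ₂ hΛ (B6RandomWalk.c1_nonneg d δ₀ β)) hα₁
  exact gExt_leftEntry_of_386 (R := R) (H := H) blk d ρ α' _ B₀ (fun a => g.len a) hB₀ (fun a => (hlen a).le) hθ hρ
    hα' hα'ρ htri hrefl hdnn h261' hsmall hDGρ h385 h386

end LeftEntries

/-! ## §6  (v1.2) Existence of `G(U′U)` on the finite lattice from (3.85): (3.84) ⇒ (3.86), and Theorem 3.4's `G`-part,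
entry (3.42)₁, with NO hypothesis on `G(U′U)` left -/

section Existence

variable {g : B9.Geometry} [Fintype g.Site] {R : ℝ} {H : Prop} {W : Type} [Fintype W] [DecidableEq W]

omit [DecidableEq W] in
/-- **(3.84)–(3.86): existence of `G(U′U)` on the finite lattice** — «hence V(A)G(U) is a small operator in supremum norm,
and we have G(U′U) = G(U)(I − V(A)G(U))⁻¹ = Σ_{n=0}^∞ G(U)(V(A)G(U))ⁿ, (3.86) and convergence is in the operator norm for α₁
sufficiently mall» [sic]: if `G(U)` is the two-sided inverse of `Δ_a(U)` (`hΔG`, `hGΔ`; (3.27)), `V(A)G(U) ≺ θe^{−ρd}` ((3.85),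
`ineq385_op`), Lemma 2.1 of [4] at `(ρ, α′)` and `θc₁(α′) < 1`, then there is an operator `G(U′U)` with both resolvent
identities of (3.86) and the two-sided inverse property for `Δ_a(U′U) = Δ_a(U) − V(A)` ((3.84)).  Instance of gen 2's
`B9Eq360Vprime.exists_gPrimeExt_of_363` (the (3.62)–(3.65) twin for `G′`) read through `toB6`.
[cite: Balaban1985BackgroundPropagators, (3.84)–(3.86) p.407 + (3.27) p.395; Balaban1984PropagatorsII, Lemma 2.1 p.234] -/
theorem exists_gExt_of_385 (blk : W → g.Site) (d : ℕ) (ρ α' θ : ℝ) (hθ : 0 ≤ θ) (hα'ρ : 0 ≤ (1 - α') * ρ)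
    (hdnn : ∀ y y' : g.Site, 0 ≤ g.dist y y') (h261 : Ineq261 d (toB6 g R H) ρ α') (hsmall : θ * B6.c1 d ρ α' < 1)
    (Δa GU V : Module.End ℝ (W → ℝ)) (hΔG : Δa * GU = 1) (hGΔ : GU * Δa = 1)
    (h385 : HasMajorant (g := toB6 g R H) blk (V * GU) (fun a b => θ * Real.exp (-(ρ * g.dist a b)))) :
    ∃ GExt : Module.End ℝ (W → ℝ),
      GExt = GU + GU * V * GExt ∧ GExt = GU + GExt * (V * GU) ∧ (Δa - V) * GExt = 1 ∧ GExt * (Δa - V) = 1 :=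
  B9Eq360Vprime.exists_gPrimeExt_of_363 (g := toB6 g R H) blk d ρ α' θ hθ hα'ρ hdnn h261 hsmall Δa GU V hΔG hGΔ h385

/-- **Theorem 3.4, `G`-part, first inequality, operator form with every intermediate hypothesis discharged** («Thus
Theorem 3.4 is proved, assuming that Theorems 3.1–3.3 hold», for the entry (3.42)₁ of `G(U′U)`): from the letters of
`ineq385_op` (V₃ = V⁰ + V¹∇ of (3.73)-shape, `P₁`/`P₂` of (3.77)/(3.83)-shape — derived in `B9Ineq377POne`/`ineq383_op` —,
Theorem 3.3's (3.42)₁,₂ for `G(U)`), the two-sided inverse property `Δ_a(U)G(U) = G(U)Δ_a(U) = I` ((3.27)) and the expansions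
(3.71) (`h371`), (3.76) (`h376`), (3.80) (`h380`, `h380s`) assembling `Δ_a(U′U)` ((3.82)–(3.84) = `B9Eq386Neumann.eq384_sub`):
for `ρ + (α+β)δ₀ ≦ δ` and `κ₃₈₅α₁c₁(α′) < 1` THERE IS an operator `G(U′U)`, the two-sided inverse of `Δ_a(U′U) =
B9Eq386Neumann.deltaA DsD′ Δp′ DRDs′ Qs′ a Q′`, with `G(U′U) ≺ B₀c₁(α′)(1 − κ₃₈₅α₁c₁(α′))⁻¹(Lʲη)²e^{−(1−α′)ρ d(y,y′)}`.
[cite: Balaban1985BackgroundPropagators, Thm 3.4 p.400 + (3.82)–(3.86) p.407 + (3.27) p.395; Balaban1984PropagatorsII, (2.66) p.234 + Lemma 2.1 p.234] -/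
theorem thm34_G_entry1_opForm (blk : W → g.Site) (d : ℕ) (δ₀ δ α β ρ α' Λ B₀ cV κ₁ κ₂ α₁ : ℝ)
    (hB₀ : 0 ≤ B₀) (hcV : 0 ≤ cV) (hκ₁ : 0 ≤ κ₁) (hκ₂ : 0 ≤ κ₂) (hα₁ : 0 ≤ α₁) (hΛ : 0 ≤ Λ) (hρ : 0 ≤ ρ)
    (hα : 0 ≤ α) (hβ : 0 ≤ β) (hδ₀ : 0 ≤ δ₀) (hr : ρ + (α + β) * δ₀ ≤ δ) (hα' : α' ≤ 1)
    (hα'ρ : 0 ≤ (1 - α') * ρ)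
    (hdnn : ∀ a b : g.Site, 0 ≤ g.dist a b) (htri : Triangle254 (toB6 g R H)) (hrefl : ∀ y : g.Site, g.dist y y = 0)
    (hlen : ∀ y : g.Site, 0 < g.len y) (h261 : Ineq261 d (toB6 g R H) δ₀ β) (h261' : Ineq261 d (toB6 g R H) ρ α')
    (hT1 : ScaleTransfer g δ₀ α Λ (fun a => g.len a)) (hT2 : ScaleTransfer g δ₀ α Λ (fun a => g.len a ^ 2))
    (hsmall : kappa385 B₀ cV κ₁ κ₂ Λ (B6.c1 d δ₀ β) * α₁ * B6.c1 d ρ α' < 1)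
    {G D V₃ V0 V1 P₁ P₂ DsD DsD' Δp Δp' DRDs DRDs' Qs Qs' Q Q' a V₁ V₂ F₂ F₂s : Module.End ℝ (W → ℝ)}
    (hV₃ : V₃ = V0 + V1 * D) (hV₃' : V₃ = B9Eq386Neumann.vThree V₁ V₂ Δp Δp')
    (h371 : DsD' = DsD - V₁) (h376 : DRDs' = DRDs - V₂ - P₁) (h380 : Q' = Q + F₂) (h380s : Qs' = Qs + F₂s)
    (hP₂def : P₂ = pTwo Qs Q F₂ F₂s a)
    (hΔG : B9Eq386Neumann.deltaA DsD Δp DRDs Qs a Q * G = 1) (hGΔ : G * B9Eq386Neumann.deltaA DsD Δp DRDs Qs a Q = 1)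
    (hV0 : HasMajorant (g := toB6 g R H) blk V0
      (fun a b => cV * α₁ * (g.len a ^ 2)⁻¹ * Real.exp (-(δ * g.dist a b))))
    (hV1 : HasMajorant (g := toB6 g R H) blk V1 (fun a b => cV * α₁ * (g.len a)⁻¹ * Real.exp (-(δ * g.dist a b))))
    (hP₁ : HasMajorant (g := toB6 g R H) blk P₁ (fun a b => κ₁ * α₁ * (g.len a ^ 2)⁻¹ * Real.exp (-(δ * g.dist a b))))
    (hP₂ : HasMajorant (g := toB6 g R H) blk P₂ (fun a b => κ₂ * α₁ * (g.len a ^ 2)⁻¹ * Real.exp (-(δ * g.dist a b))))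
    (hG : HasMajorant (g := toB6 g R H) blk G (fun a b => B₀ * g.len a ^ 2 * Real.exp (-(δ * g.dist a b))))
    (hDG : HasMajorant (g := toB6 g R H) blk (D * G) (fun a b => B₀ * g.len a * Real.exp (-(δ * g.dist a b)))) :
    ∃ GExt : Module.End ℝ (W → ℝ),
      B9Eq386Neumann.deltaA DsD' Δp' DRDs' Qs' a Q' * GExt = 1 ∧ GExt * B9Eq386Neumann.deltaA DsD' Δp' DRDs' Qs' a Q' = 1 ∧
      HasMajorant (g := toB6 g R H) blk GExt
        (fun a b => B₀ * B6.c1 d ρ α' * (1 - kappa385 B₀ cV κ₁ κ₂ Λ (B6.c1 d δ₀ β) * α₁ * B6.c1 d ρ α')⁻¹ *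
          g.len a ^ 2 * Real.exp (-((1 - α') * ρ * g.dist a b))) := by
  -- (3.85)
  have h385 := ineq385_op (R := R) (H := H) blk d δ₀ δ α β ρ Λ B₀ cV κ₁ κ₂ α₁ hB₀ hcV hκ₁ hκ₂ hα₁ hΛ hρ hα hβ hδ₀ hr
    hdnn htri hlen h261 hT1 hT2 hV₃ hV0 hV1 hP₁ hP₂ hG hDG
  have hθ : 0 ≤ kappa385 B₀ cV κ₁ κ₂ Λ (B6.c1 d δ₀ β) * α₁ :=
    mul_nonneg (kappa385_nonneg hB₀ hcV hκ₁ hκ₂ hΛ (B6RandomWalk.c1_nonneg d δ₀ β)) hα₁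
  -- (3.84): Δ_a(U′U) = Δ_a(U) − V(A)
  have h384 : B9Eq386Neumann.deltaA DsD' Δp' DRDs' Qs' a Q' =
      B9Eq386Neumann.deltaA DsD Δp DRDs Qs a Q - vTotal V₃ P₁ P₂ := by
    rw [B9Eq386Neumann.eq384_sub DsD DsD' Δp Δp' DRDs DRDs' Qs Qs' Q Q' a V₁ V₂ P₁ F₂ F₂s h371 h376 h380 h380s,
      hV₃', hP₂def]
  -- (3.86): existence with the resolvent identities and the inverse property
  obtain ⟨GExt, -, h386, hL, hR⟩ := exists_gExt_of_385 (R := R) (H := H) blk d ρ α' _ hθ hα'ρ hdnn h261' hsmall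
    (B9Eq386Neumann.deltaA DsD Δp DRDs Qs a Q) G (vTotal V₃ P₁ P₂) hΔG hGΔ h385
  refine ⟨GExt, ?_, ?_, ?_⟩
  · rw [h384]; exact hL
  · rw [h384]; exact hR
  · have hρδ : ρ ≤ δ := by
      have : 0 ≤ (α + β) * δ₀ := by positivity
      linarith
    have hGρ := hasMajorant_rate_mono (R := R) (H := H) blk B₀ (fun a => g.len a ^ 2) hB₀ (fun a => sq_nonneg _) hρδ
      hdnn hG
    exact gExt_entry1_of_386 (R := R) (H := H) blk d ρ α' _ B₀ (fun a => g.len a ^ 2) hB₀ (fun a => sq_nonneg _) hθ hρ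
      hα' hα'ρ htri hrefl hdnn h261' hsmall hGρ h385 h386

end Existence

end Literature.MathematicalPhysics.QuantumFieldTheory.Balaban1983to89.B9Ineq385VG

end
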